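import Summits.ResolutionOfSingularities.ResolutionOfSingularities.Theorems.WildConesClassicalRegimesStubOrdPExitSurface
import Summits.ResolutionOfSingularities.ResolutionOfSingularities.Theorems.WildConesNarrowRunsDieStubDict
import Summits.ResolutionOfSingularities.ResolutionOfSingularities.Theorems.FrobeniusClosingClosingReductionFactorization
import Literature.RingTheory.MvPowerSeries.PartialDerivative
import Literature.RingTheory.TwoVariableSeries.Basic

/-!
# Crux `ClassicalRegimes` (stmt-ResolutionOfSingularities-16884), line `milnor-descent` — the surface
# step as a substitution, and its partial derivatives

Helper file for the lead's stub `stub_muDropSurfaceOrdSucc` (`n = 2`, cleaned order `p + 1`). For a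
state `c : (Fin 2 → ℕ) → κ` of multiplicity `p` (`MultP`), chart `i`, translation `τ`, other index `j`:

* `chartMap_ser_eq` — THE DICTIONARY (instance of `WildCones.NarrowRunsDie.stub_dict`, landed by the
  sibling crux): `σ(ser c) = X_i^p · T` where `σ = chartMap 2 κ i τ` is the honest substitution
  `X_i ↦ X_i, X_j ↦ X_i (X_j + τ_j)` (route `FrobeniusClosing`'s `chartMap`, same body) and `T` is the
  series of the route's `tr i τ p (dv i p (bl i (clean c)))`;
* `pd_ser_step_eq` — the successor's gradient is the gradient of `T`: cleaning (deleting `p`-th powers)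
  does not change partial derivatives in characteristic `p`;
* `X_pow_mul_pd_other_eq`, `X_pow_mul_pd_self_eq` — the CHAIN RULE through `σ` in characteristic `p`
  (`d(X_i^{-p} g) = X_i^{-p} dg`): `X_i^p ∂_j T = X_i · σ(∂_j a)` and
  `X_i^p ∂_i T = σ(∂_i a) + (X_j + τ_j) σ(∂_j a)` (`a = ser c`).

Registered as sub-goal `surfaceDict` of the crux (lead, `--supports`).
-/

noncomputable section

-- single-problem summit: the doubled namespace component `ResolutionOfSingularities` is forced
set_option linter.dupNamespace false

open scoped BigOperators Classical
open MvPowerSeries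

namespace Summit.ResolutionOfSingularities.ResolutionOfSingularities.Theorems.WildCones

open Summit.ResolutionOfSingularities.ResolutionOfSingularities.Theorems.FrobeniusClosing (chartSubst chartMap)
open Summit.ResolutionOfSingularities.ResolutionOfSingularities.Theorems.FrobeniusClosing.FactorizationProof
  (hasSubst_chartSubst chartMap_X_self chartMap_X_of_ne)

namespace MuDropSurface

variable {p : ℕ} {κ : Type} [Field κ]

/-! ### The dictionary -/

/-- **Dictionary** (instance of the sibling crux's `stub_dict`): for a state of multiplicity `p`,
`σ_{i,τ}(ser c) = X_i^p · T` with `T` the series of `tr i τ p (dv i p (bl i (clean c)))`. [folklore] -/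
theorem chartMap_ser_eq (c : (Fin 2 → ℕ) → κ) (i : Fin 2) (τ : Fin 2 → κ) (hM : MultP p 2 κ c) :
    chartMap 2 κ i τ (ser p 2 κ c) =
      X i ^ p * (show MvPowerSeries (Fin 2) κ from
        fun A : Fin 2 →₀ ℕ => tr 2 κ i τ p (dv 2 κ i p (bl 2 κ i (clean p 2 κ c))) ⇑A) := by
  have hvan : ∀ A, clean p 2 κ c A ≠ 0 → p ≤ Finset.sum Finset.univ (fun j => A j) := hM.2
  have h := Summit.ResolutionOfSingularities.ResolutionOfSingularities.Theorems.NarrowRunsDie.stub_dict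
    2 κ (clean p 2 κ c) i τ p hvan
  -- the sibling's substitution family uses `Classical.dec`; `chartSubst` uses `Fin`'s decidability
  have hfam : (fun j : Fin 2 => @ite (MvPowerSeries (Fin 2) κ) (j = i) (Classical.dec _) (MvPowerSeries.X i)
      (MvPowerSeries.X i * (MvPowerSeries.X j + MvPowerSeries.C (τ j)))) = chartSubst 2 κ i τ := by
    funext j
    by_cases hj : j = i <;> simp [chartSubst, hj]
  change MvPowerSeries.subst (chartSubst 2 κ i τ) (ser p 2 κ c) = _
  rw [← hfam]
  exact h

/-- Under `MultP c` the successor is the cleaning of `tr ∘ dv ∘ bl` (division exponent `p`), so its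
cleaned series has coefficients `clean (tr … (dv … (bl … (clean c))))`. [folklore] -/
theorem coeff_ser_step (c : (Fin 2 → ℕ) → κ) (i : Fin 2) (τ : Fin 2 → κ) (hM : MultP p 2 κ c)
    (A : Fin 2 →₀ ℕ) :
    coeff A (ser p 2 κ (step p 2 κ i τ c)) =
      clean p 2 κ (tr 2 κ i τ p (dv 2 κ i p (bl 2 κ i (clean p 2 κ c)))) ⇑A := by
  rw [OrdPExitSurface.step_eq i τ hM]
  change clean p 2 κ (clean p 2 κ _) ⇑A = _
  unfold clean
  by_cases h : ∀ j, p ∣ A j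
  · rw [if_pos h, if_pos h]
  · rw [if_neg h, if_neg h]

/-- Coefficients of the hand-rolled partial derivative. [folklore] -/
theorem coeff_pd (l : Fin 2) (f : MvPowerSeries (Fin 2) κ) (A : Fin 2 →₀ ℕ) :
    coeff A (pd 2 κ l f) = ((A l + 1 : ℕ) : κ) * coeff (A + Finsupp.single l 1) f := rfl

/-- The hand-rolled `pd` is the linear partial derivative `Literature.RingTheory.MvPowerSeries.pd`
(same coefficient formula). [folklore] -/
theorem pd_eq_pd (l : Fin 2) (f : MvPowerSeries (Fin 2) κ) :
    pd 2 κ l f = Literature.RingTheory.MvPowerSeries.pd l f := by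
  ext A
  rw [coeff_pd, Literature.RingTheory.MvPowerSeries.coeff_pd]

/-- **Cleaning does not change gradients in characteristic `p`**: the successor's partials are the
partials of `T`. [folklore] -/
theorem pd_ser_step_eq [CharP κ p] (c : (Fin 2 → ℕ) → κ) (i : Fin 2) (τ : Fin 2 → κ)
    (hM : MultP p 2 κ c) (l : Fin 2) :
    pd 2 κ l (ser p 2 κ (step p 2 κ i τ c)) =
      pd 2 κ l (show MvPowerSeries (Fin 2) κ from
        fun A : Fin 2 →₀ ℕ => tr 2 κ i τ p (dv 2 κ i p (bl 2 κ i (clean p 2 κ c))) ⇑A) := by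
  ext A
  rw [coeff_pd, coeff_pd, coeff_ser_step c i τ hM]
  change _ * clean p 2 κ _ ⇑(A + Finsupp.single l 1 : Fin 2 →₀ ℕ) =
    _ * tr 2 κ i τ p _ ⇑(A + Finsupp.single l 1 : Fin 2 →₀ ℕ)
  unfold clean
  by_cases h : ∀ j, p ∣ (⇑(A + Finsupp.single l 1 : Fin 2 →₀ ℕ)) j
  · have hl : p ∣ A l + 1 := by simpa using h l
    have h0 : ((A l + 1 : ℕ) : κ) = 0 := (CharP.cast_eq_zero_iff κ p _).mpr hl
    rw [h0, zero_mul, zero_mul]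
  · rw [if_neg h]

/-! ### The chain rule through the chart map -/

/-- Sum over `Fin 2` as the sum over the two indices `i`, `j ≠ i`. [folklore] -/
theorem sum_univ_two_eq {i j : Fin 2} (hj : j ≠ i) {M : Type} [AddCommMonoid M] (F : Fin 2 → M) :
    ∑ l, F l = F i + F j := by
  rw [← Finset.add_sum_erase Finset.univ F (Finset.mem_univ i), OrdPExitSurface.univ_erase_eq hj,
    Finset.sum_singleton]

/-- Chain rule, variable `j ≠ i`: `∂_j σ(f) = σ(∂_j f) · X_i`. [folklore] -/
theorem pd_other_chartMap {i j : Fin 2} (hj : j ≠ i) (τ : Fin 2 → κ) (f : MvPowerSeries (Fin 2) κ) :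
    pd 2 κ j (chartMap 2 κ i τ f) = chartMap 2 κ i τ (pd 2 κ j f) * X i := by
  rw [pd_eq_pd, pd_eq_pd]
  unfold chartMap
  rw [Literature.RingTheory.MvPowerSeries.pd_subst (chartSubst 2 κ i τ)
      (Summit.ResolutionOfSingularities.ResolutionOfSingularities.Theorems.FrobeniusClosing.FactorizationProof.constantCoeff_chartSubst i τ),
    sum_univ_two_eq hj]
  have hi : Literature.RingTheory.MvPowerSeries.pd j (chartSubst 2 κ i τ i) = 0 := by
    unfold chartSubst
    rw [if_pos rfl, Literature.RingTheory.MvPowerSeries.pd_X, if_neg hj.symm]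
  have hj' : Literature.RingTheory.MvPowerSeries.pd j (chartSubst 2 κ i τ j) = X i := by
    unfold chartSubst
    rw [if_neg hj, Literature.RingTheory.MvPowerSeries.pd_mul, Literature.RingTheory.MvPowerSeries.pd_X,
      if_neg hj.symm, zero_mul, zero_add, map_add, Literature.RingTheory.MvPowerSeries.pd_X, if_pos rfl,
      Literature.RingTheory.MvPowerSeries.pd_C, add_zero, mul_one]
  rw [hi, hj', mul_zero, zero_add]

/-- Chain rule, variable `i`: `∂_i σ(f) = σ(∂_i f) + σ(∂_j f) · (X_j + τ_j)`. [folklore] -/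
theorem pd_self_chartMap {i j : Fin 2} (hj : j ≠ i) (τ : Fin 2 → κ) (f : MvPowerSeries (Fin 2) κ) :
    pd 2 κ i (chartMap 2 κ i τ f) =
      chartMap 2 κ i τ (pd 2 κ i f) + chartMap 2 κ i τ (pd 2 κ j f) * (X j + C (τ j)) := by
  rw [pd_eq_pd, pd_eq_pd, pd_eq_pd]
  unfold chartMap
  rw [Literature.RingTheory.MvPowerSeries.pd_subst (chartSubst 2 κ i τ)
      (Summit.ResolutionOfSingularities.ResolutionOfSingularities.Theorems.FrobeniusClosing.FactorizationProof.constantCoeff_chartSubst i τ),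
    sum_univ_two_eq hj]
  have hi : Literature.RingTheory.MvPowerSeries.pd i (chartSubst 2 κ i τ i) = 1 := by
    unfold chartSubst
    rw [if_pos rfl, Literature.RingTheory.MvPowerSeries.pd_X, if_pos rfl]
  have hj' : Literature.RingTheory.MvPowerSeries.pd i (chartSubst 2 κ i τ j) = X j + C (τ j) := by
    unfold chartSubst
    rw [if_neg hj, Literature.RingTheory.MvPowerSeries.pd_mul, Literature.RingTheory.MvPowerSeries.pd_X,
      if_pos rfl, one_mul, map_add, Literature.RingTheory.MvPowerSeries.pd_X, if_neg hj,
      Literature.RingTheory.MvPowerSeries.pd_C, add_zero, mul_zero, add_zero]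
  rw [hi, hj', mul_one]

/-- Leibniz through `X_i^p` in characteristic `p`: `∂_l (X_i^p T) = X_i^p ∂_l T`. [folklore] -/
theorem pd_X_pow_mul [CharP κ p] (hp : p.Prime) (i l : Fin 2) (T : MvPowerSeries (Fin 2) κ) :
    pd 2 κ l (X i ^ p * T) = X i ^ p * pd 2 κ l T := by
  haveI : CharP (MvPowerSeries (Fin 2) κ) p := Literature.RingTheory.TwoVariableSeries.charP_mvPowerSeries _ p
  obtain ⟨m, hm⟩ : ∃ m, p = m + 1 := ⟨p - 1, (Nat.succ_pred_eq_of_pos hp.pos).symm⟩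
  rw [pd_eq_pd, pd_eq_pd, Literature.RingTheory.MvPowerSeries.pd_mul, hm,
    Literature.RingTheory.MvPowerSeries.pd_pow_succ, ← hm, CharP.cast_eq_zero, zero_mul, zero_mul, zero_mul,
    zero_add]

/-- **Chain rule for the successor, variable `j`**: `X_i^p · ∂_j T = σ(∂_j a) · X_i`. [folklore] -/
theorem X_pow_mul_pd_other_eq [CharP κ p] (hp : p.Prime) (c : (Fin 2 → ℕ) → κ) {i j : Fin 2}
    (hj : j ≠ i) (τ : Fin 2 → κ) (hM : MultP p 2 κ c) :
    X i ^ p * pd 2 κ j (show MvPowerSeries (Fin 2) κ from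
        fun A : Fin 2 →₀ ℕ => tr 2 κ i τ p (dv 2 κ i p (bl 2 κ i (clean p 2 κ c))) ⇑A) =
      chartMap 2 κ i τ (pd 2 κ j (ser p 2 κ c)) * X i := by
  rw [← pd_X_pow_mul hp, ← chartMap_ser_eq c i τ hM, pd_other_chartMap hj]

/-- **Chain rule for the successor, variable `i`**:
`X_i^p · ∂_i T = σ(∂_i a) + σ(∂_j a) · (X_j + τ_j)`. [folklore] -/
theorem X_pow_mul_pd_self_eq [CharP κ p] (hp : p.Prime) (c : (Fin 2 → ℕ) → κ) {i j : Fin 2}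
    (hj : j ≠ i) (τ : Fin 2 → κ) (hM : MultP p 2 κ c) :
    X i ^ p * pd 2 κ i (show MvPowerSeries (Fin 2) κ from
        fun A : Fin 2 →₀ ℕ => tr 2 κ i τ p (dv 2 κ i p (bl 2 κ i (clean p 2 κ c))) ⇑A) =
      chartMap 2 κ i τ (pd 2 κ i (ser p 2 κ c)) +
        chartMap 2 κ i τ (pd 2 κ j (ser p 2 κ c)) * (X j + C (τ j)) := by
  rw [← pd_X_pow_mul hp, ← chartMap_ser_eq c i τ hM, pd_self_chartMap hj]

end MuDropSurface

/-- **Surface step dictionary with gradients** (sub-goal `surfaceDict` of crux `ClassicalRegimes`,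
line `milnor-descent`): for a state of multiplicity `p` in two variables, chart `i`, other index `j`,
translation `τ`, there is a series `T` whose partials ARE the partials of the successor's cleaned
series, with `σ(ser c) = X_i^p T`, `X_i^p ∂_j T = σ(∂_j ser c) X_i` and
`X_i^p ∂_i T = σ(∂_i ser c) + σ(∂_j ser c)(X_j + τ_j)`, where `σ = chartMap 2 κ i τ`. [folklore] -/
theorem surfaceDict : ∀ p : ℕ, p.Prime → ∀ (κ : Type) [Field κ] [CharP κ p]
    (c : (Fin 2 → ℕ) → κ) (i j : Fin 2), j ≠ i → ∀ τ : Fin 2 → κ, MultP p 2 κ c →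
    ∃ T : MvPowerSeries (Fin 2) κ,
      chartMap 2 κ i τ (ser p 2 κ c) = X i ^ p * T ∧
      (∀ l, pd 2 κ l (ser p 2 κ (step p 2 κ i τ c)) = pd 2 κ l T) ∧
      X i ^ p * pd 2 κ j T = chartMap 2 κ i τ (pd 2 κ j (ser p 2 κ c)) * X i ∧
      X i ^ p * pd 2 κ i T = chartMap 2 κ i τ (pd 2 κ i (ser p 2 κ c)) +
        chartMap 2 κ i τ (pd 2 κ j (ser p 2 κ c)) * (X j + C (τ j)) := by
  intro p hp κ _ _ c i j hj τ hM
  exact ⟨_, MuDropSurface.chartMap_ser_eq c i τ hM, MuDropSurface.pd_ser_step_eq c i τ hM,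
    MuDropSurface.X_pow_mul_pd_other_eq hp c hj τ hM, MuDropSurface.X_pow_mul_pd_self_eq hp c hj τ hM⟩

end Summit.ResolutionOfSingularities.ResolutionOfSingularities.Theorems.WildCones

end
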